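import Literature.AnabelianGeometry.EtaleTheta.ThetaEnvOfSetting
import Literature.AnabelianGeometry.EtaleTheta.ThetaRigidity
import HarnessLib

/-!
# [EtTh] §2 over §1: all theta sections of `X̲̲` are `K^×, (l·ℤ)`-conjugate (merge adapter, part 2c)

Mochizuki, *The étale theta function …*, Publ. RIMS **45** (2009), §2, PRIMS PDF pp. 46–47 (printed
272–273) [cite: MochizukiEtTh2009, Def 2.13 p.47]. Layer L2 of the abc-iut cell, wave-2 unit W2-L2-04,
seat abc-iut-L2-t8. Continuation of `ThetaEnvOfSetting.lean`.

The text (pp. 46–47): "the various `s^Θ_Ÿ̲̲` that arise from different choices of [a cocycle contained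
in] a class `∈ η̲̈^{Θ,l·ℤ×μ₂}` are obtained as `Π^tp_X̲̲[μ_N]`-conjugates of any given `s^Θ_Ÿ̲̲`" [conjugation
by `μ_N` "corresponds precisely to modifying a cocycle by a coboundary"], and "replacing
`η̲̈^{Θ,l·ℤ×μ₂}` by an `O^×_K`-multiple … corresponds to replacing `s^Θ_Ÿ̲̲` by an `O^×_K`-conjugate"
[relative to the Kummer action of `K^×`]. Seat abc-iut-L2-t2's `RigidData` (`ThetaRigidity.lean`) records
this as the axiom `thetaSections_conj` in terms of `ThetaEnvData.IsKLConjugate` (conjugation by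
`Π^tp_X̲̲`, shifts by cocycles inflated from `G_K`). Here it is PROVED for the instantiated data
`DoubleUnderline.thetaEnvData`: two theta cocycles of the collection come from `l·Δ_Θ`-valued root
cocycles `f, f'` with `f' = (τ-conjugate of f) · ∂c` for some `τ ∈ Π^tp_X̲̲`, `c ∈ Δ_Θ`
(`rootCocycles_rel`), and on sections `τ` acts through `conjX τ` while `∂c` — whose values depend on
`g` only through `aug g`, `Δ_Θ` being central in `(Δ^tp_X)^Θ` — acts through the shift by a cocycle
inflated from `G_K` (`thetaSections_isKLConjugate`). HONEST FRAMING as in parts 0–3.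
-/

noncomputable section

namespace Literature.AnabelianGeometry.EtaleTheta

open Literature.AnabelianGeometry.SemiGraphs

namespace ThetaSetting

namespace EtaleThetaData.DoubleUnderline

variable {p : ℕ} [Fact p.Prime] {D : ThetaSetting p} {E : D.EtaleThetaData} {l : ℕ}
  (C : E.DoubleUnderline l) {N : ℕ+} (μ : D.CyclotomeMod l N)

/-! ### Conjugating root cocycles by `Π^tp_X̲̲` -/

open scoped IsMulCommutative

/-- `τ⁻¹ k τ ∈ Π^tp_Ÿ` for `τ ∈ Π^tp_X̲̲`, `k ∈ Π^tp_Ÿ̲̲` (`Π^tp_Ÿ` is normal in `Π^tp_X`).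
[cite: MochizukiEtTh2009, Def 2.13 p.46] -/
theorem conj_mem_GtpYdd (hC : D.Compat) (τ : C.Huu) (k : C.GtpYdduu) :
    (τ : D.PiTemp)⁻¹ * k * τ ∈ D.GtpYdd := by
  simpa using hC.GtpYdd_normal.conj_mem _ (Subgroup.mem_inf.1 k.2).1 (τ : D.PiTemp)⁻¹

/-- `τ⁻¹ k τ ∈ Π^tp_Ÿ̲̲` for `τ ∈ Π^tp_X̲̲`, `k ∈ Π^tp_Ÿ̲̲`. [cite: MochizukiEtTh2009, Def 2.13 p.46] -/
theorem conj_mem_GtpYdduu (hC : D.Compat) (τ : C.Huu) (k : C.GtpYdduu) :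
    (τ : D.PiTemp)⁻¹ * k * τ ∈ C.GtpYdduu :=
  Subgroup.mem_inf.2 ⟨C.conj_mem_GtpYdd hC τ k,
    C.Huu.mul_mem (C.Huu.mul_mem (C.Huu.inv_mem τ.2) (Subgroup.mem_inf.1 k.2).2) τ.2⟩

/-- The `τ`-conjugate `k ↦ τ̄ · f(τ⁻¹ k τ) · τ̄⁻¹` of a function on `Π^tp_Ÿ̲̲` (`τ ∈ Π^tp_X̲̲`, `τ̄` its image in
`(Π^tp_X)^Θ` acting on `Δ_Θ` by conjugation). [cite: MochizukiEtTh2009, Def 2.13 p.46] -/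
def conjRoot (hC : D.Compat) (τ : C.Huu) (f : C.GtpYdduu → D.DeltaTheta) : C.GtpYdduu → D.DeltaTheta :=
  fun k => MulAut.conjNormal (D.toTheta (τ : D.PiTemp)) (f ⟨_, C.conj_mem_GtpYdduu hC τ k⟩)

/-- A member of `rootCocycles`, unfolded: `f = (σ-conjugate of a representative of η̈^Θ) · ∂b` on
`Π^tp_Ÿ̲̲`, for some `σ ∈ Π^tp_X̲̲`, `b ∈ Δ_Θ`. [cite: MochizukiEtTh2009, Def 2.13 p.46] -/
theorem rootCocycle_eq (hC : D.Compat) {f : contCocycles D.toTheta D.DeltaTheta C.GtpYdduu}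
    (hf : f ∈ C.rootCocycles hC) (f₀ : contCocycles D.toTheta D.DeltaTheta D.GtpYdd)
    (hf₀ : (QuotientGroup.mk f₀ : D.H1 D.GtpYdd) = E.etaDd) :
    ∃ σ : C.Huu, ∃ b : D.DeltaTheta, ∀ k : C.GtpYdduu,
      f.1 k = MulAut.conjNormal (D.toTheta (σ : D.PiTemp))
          (f₀.1 ⟨(σ : D.PiTemp)⁻¹ * k * σ, C.conj_mem_GtpYdd hC σ k⟩) *
        (MulAut.conjNormal (D.toTheta (k : D.PiTemp)) b * b⁻¹) := by
  haveI := hC.GtpYdd_normal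
  obtain ⟨σ, hσ, hclass⟩ := hf.2
  set g := ContH1.resCocycle D.toTheta D.DeltaTheta (inf_le_left : C.GtpYdduu ≤ D.GtpYdd)
    (ContH1.conjCocycle D.toTheta D.DeltaTheta σ f₀) with hg
  have e1 : (QuotientGroup.mk g : D.H1 C.GtpYdduu) = QuotientGroup.mk f := by
    rw [← hf₀] at hclass
    exact hclass.symm
  rw [QuotientGroup.eq, Subgroup.mem_subgroupOf, mem_contCoboundaries_iff] at e1
  obtain ⟨b, hb⟩ := e1
  refine ⟨⟨σ, hσ⟩, b, fun k => ?_⟩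
  have hk : (g.1 k)⁻¹ * f.1 k = MulAut.conjNormal (D.toTheta (k : D.PiTemp)) b * b⁻¹ :=
    congrFun hb k
  have hk' : f.1 k = g.1 k * (MulAut.conjNormal (D.toTheta (k : D.PiTemp)) b * b⁻¹) := by
    rw [← hk, mul_inv_cancel_left]
  rw [hk']
  congr 1
  have hu : (MulAut.conjNormal σ⁻¹ (⟨(k : D.PiTemp), (Subgroup.mem_inf.1 k.2).1⟩ : D.GtpYdd) :
      D.GtpYdd) = ⟨(σ : D.PiTemp)⁻¹ * k * σ, C.conj_mem_GtpYdd hC ⟨σ, hσ⟩ k⟩ := by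
    apply Subtype.ext
    rw [MulAut.conjNormal_apply, inv_inv]
  change MulAut.conjNormal (D.toTheta σ) (f₀.1 (MulAut.conjNormal σ⁻¹ ⟨(k : D.PiTemp),
    (Subgroup.mem_inf.1 k.2).1⟩)) = _
  rw [hu]

/-- **Two root cocycles differ by a `Π^tp_X̲̲`-conjugation and an `l·Δ_Θ`-valued coboundary**:
`f' = (τ-conjugate of f) · ∂c` with `τ ∈ Π^tp_X̲̲`, `c ∈ Δ_Θ` (their classes are `Π^tp_X̲̲`-conjugate;
"conjugation by an element of `μ_N` corresponds precisely to modifying a cocycle by a coboundary",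
p. 47; the lift ambiguity "up to a root of unity of order `l`", Cor. 2.8 (i), is again a coboundary `∂c`,
`c ∈ Δ_Θ`). [cite: MochizukiEtTh2009, Def 2.13 p.47] -/
theorem rootCocycles_rel (hC : D.Compat) {f f' : contCocycles D.toTheta D.DeltaTheta C.GtpYdduu}
    (hf : f ∈ C.rootCocycles hC) (hf' : f' ∈ C.rootCocycles hC) :
    ∃ τ : C.Huu, ∃ c : D.DeltaTheta, ∀ k : C.GtpYdduu,
      f'.1 k = C.conjRoot hC τ f.1 k * (MulAut.conjNormal (D.toTheta (k : D.PiTemp)) c * c⁻¹) := by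
  haveI := hC.GtpYdd_normal
  obtain ⟨f₀, hf₀⟩ : ∃ f₀ : contCocycles D.toTheta D.DeltaTheta D.GtpYdd,
      (QuotientGroup.mk f₀ : D.H1 D.GtpYdd) = E.etaDd := QuotientGroup.mk_surjective _
  obtain ⟨σ, b, hσ⟩ := C.rootCocycle_eq hC hf f₀ hf₀
  obtain ⟨σ', b', hσ'⟩ := C.rootCocycle_eq hC hf' f₀ hf₀
  -- `τ := σ' σ⁻¹`, `c := b' · (τ̄ b τ̄⁻¹)⁻¹`
  refine ⟨σ' * σ⁻¹, b' * (MulAut.conjNormal (D.toTheta ((σ' * σ⁻¹ : C.Huu) : D.PiTemp)) b)⁻¹,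
    fun k => ?_⟩
  -- the point `σ⁻¹ (τ⁻¹ k τ) σ = σ'⁻¹ k σ'` at which `f₀` is evaluated on both sides
  have hpt : (⟨(σ : D.PiTemp)⁻¹ * ((⟨_, C.conj_mem_GtpYdduu hC (σ' * σ⁻¹) k⟩ : C.GtpYdduu) :
      D.PiTemp) * σ, C.conj_mem_GtpYdd hC σ ⟨_, C.conj_mem_GtpYdduu hC (σ' * σ⁻¹) k⟩⟩ : D.GtpYdd) =
      ⟨(σ' : D.PiTemp)⁻¹ * k * σ', C.conj_mem_GtpYdd hC σ' k⟩ := by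
    apply Subtype.ext
    change (σ : D.PiTemp)⁻¹ * (((σ' * σ⁻¹ : C.Huu) : D.PiTemp)⁻¹ * k *
      ((σ' * σ⁻¹ : C.Huu) : D.PiTemp)) * σ = (σ' : D.PiTemp)⁻¹ * k * σ'
    rw [Subgroup.coe_mul, Subgroup.coe_inv]
    group
  -- the images in `(Π^tp_X)^Θ`
  have hts : D.toTheta ((σ' * σ⁻¹ : C.Huu) : D.PiTemp) * D.toTheta (σ : D.PiTemp) =
      D.toTheta (σ' : D.PiTemp) := by
    rw [Subgroup.coe_mul, Subgroup.coe_inv, map_mul, map_inv, inv_mul_cancel_right]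
  have hkτ : D.toTheta (((⟨_, C.conj_mem_GtpYdduu hC (σ' * σ⁻¹) k⟩ : C.GtpYdduu)) : D.PiTemp) =
      (D.toTheta ((σ' * σ⁻¹ : C.Huu) : D.PiTemp))⁻¹ * D.toTheta (k : D.PiTemp) *
        D.toTheta ((σ' * σ⁻¹ : C.Huu) : D.PiTemp) := by
    change D.toTheta (((σ' * σ⁻¹ : C.Huu) : D.PiTemp)⁻¹ * k * ((σ' * σ⁻¹ : C.Huu) : D.PiTemp)) = _
    rw [map_mul, map_mul, map_inv]
  rw [hσ' k]
  change _ = MulAut.conjNormal (D.toTheta ((σ' * σ⁻¹ : C.Huu) : D.PiTemp))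
    (f.1 ⟨_, C.conj_mem_GtpYdduu hC (σ' * σ⁻¹) k⟩) * _
  rw [hσ ⟨_, C.conj_mem_GtpYdduu hC (σ' * σ⁻¹) k⟩, hpt, hkτ, ← hts]
  -- now a commutative-group identity in `Δ_Θ` between values of the conjugation action
  set tτ := D.toTheta ((σ' * σ⁻¹ : C.Huu) : D.PiTemp)
  set s := D.toTheta (σ : D.PiTemp)
  set tk := D.toTheta (k : D.PiTemp)
  set F := f₀.1 ⟨(σ' : D.PiTemp)⁻¹ * k * σ', C.conj_mem_GtpYdd hC σ' k⟩
  simp only [map_mul, map_inv, MulAut.mul_apply, MulAut.inv_apply, MulEquiv.apply_symm_apply,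
    mul_inv_rev, inv_inv]
  apply (Additive.ofMul : D.DeltaTheta ≃ Additive D.DeltaTheta).injective
  simp only [ofMul_mul, ofMul_inv]
  abel

/-! ### Coboundary values and their independence of the lift -/

/-- The coboundary value `∂c(t) = t c t⁻¹ · c⁻¹ ∈ Δ_Θ` at `t ∈ (Π^tp_X)^Θ`.
[cite: MochizukiEtTh2009, Prop 2.14 (ii) p.49] -/
def cobAt (c : D.DeltaTheta) (t : D.GtpTheta) : D.DeltaTheta := MulAut.conjNormal t c * c⁻¹

/-- `∂c` is a 1-cocycle: `∂c(t t') = ∂c(t) · t ∂c(t') t⁻¹`. [cite: MochizukiEtTh2009, Prop 2.14 (ii) p.49] -/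
theorem cobAt_mul (c : D.DeltaTheta) (t t' : D.GtpTheta) :
    cobAt c (t * t') = cobAt c t * MulAut.conjNormal t (cobAt c t') := by
  simp only [cobAt, map_mul, MulAut.mul_apply, map_inv]
  apply (Additive.ofMul : D.DeltaTheta ≃ Additive D.DeltaTheta).injective
  simp only [ofMul_mul, ofMul_inv]
  abel

/-- `∂c(x̄)` depends on `x ∈ Π^tp_X` only through its image in `G_K`: `Δ^tp_X` acts trivially on `Δ_Θ`
(`Δ_Θ` is central in `(Δ^tp_X)^Θ`, p. 12). [cite: MochizukiEtTh2009, §1 p.12] -/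
theorem cobAt_eq_of_aug_eq (c : D.DeltaTheta) {x y : D.PiTemp}
    (h : D.aug.toMonoidHom x = D.aug.toMonoidHom y) :
    cobAt c (D.toTheta x) = cobAt c (D.toTheta y) := by
  have hd : x⁻¹ * y ∈ D.aug.toMonoidHom.ker := by
    rw [MonoidHom.mem_ker, map_mul, map_inv, h, inv_mul_cancel]
  have hc : MulAut.conjNormal (D.toTheta (x⁻¹ * y)) c = c := by
    apply Subtype.ext
    rw [MulAut.conjNormal_apply]
    have := D.ker_thetaToEll_central (c : D.GtpTheta) c.2 (D.toTheta (x⁻¹ * y)) ⟨x⁻¹ * y, hd, rfl⟩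
    rw [← this, mul_inv_cancel_right]
  have hy : y = x * (x⁻¹ * y) := by group
  unfold cobAt
  conv_rhs => rw [hy, map_mul, map_mul, MulAut.mul_apply, hc]

/-! ### All theta sections are `K^×, (l·ℤ)`-conjugate -/

section Sections

/-- Every element of `G_K` lifts to `Π^tp_Ÿ̲̲` (`map_aug_Ydduu`). [cite: MochizukiEtTh2009, Prop 2.2 (iii) p.37] -/
theorem exists_lift (γ : D.GK) : ∃ k : C.GtpYdduu, D.aug.toMonoidHom (k : D.PiTemp) = γ := by
  have h : (γ : GQp p) ∈ (D.GtpYdd ⊓ C.Huu).map D.aug.toMonoidHom := by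
    rw [C.map_aug_Ydduu]; exact γ.2
  obtain ⟨k, hk, hkγ⟩ := h
  exact ⟨⟨k, hk⟩, hkγ⟩

/-- A chosen lift `G_K → Π^tp_Ÿ̲̲`. [cite: MochizukiEtTh2009, Prop 2.2 (iii) p.37] -/
def lift (γ : D.GK) : C.GtpYdduu := Classical.choose (C.exists_lift γ)

/-- The chosen lift lifts. [cite: MochizukiEtTh2009, Prop 2.2 (iii) p.37] -/
theorem aug_lift (γ : D.GK) : D.aug.toMonoidHom (C.lift γ : D.PiTemp) = γ :=
  Classical.choose_spec (C.exists_lift γ)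

variable {C}

/-- In the situation of `rootCocycles_rel`, the coboundary `∂c` is `l·Δ_Θ`-valued on `Π^tp_Ÿ̲̲` (both
`f'` and the conjugate of `f` are). [cite: MochizukiEtTh2009, Def 2.13 p.47] -/
theorem cobAt_mem (hC : D.Compat) {f f' : contCocycles D.toTheta D.DeltaTheta C.GtpYdduu}
    (hf : f ∈ C.rootCocycles hC) (hf' : f' ∈ C.rootCocycles hC) {τ : C.Huu} {c : D.DeltaTheta}
    (hrel : ∀ k : C.GtpYdduu,
      f'.1 k = C.conjRoot hC τ f.1 k * (MulAut.conjNormal (D.toTheta (k : D.PiTemp)) c * c⁻¹))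
    (k : C.GtpYdduu) : (cobAt c (D.toTheta (k : D.PiTemp)) : D.GtpTheta) ∈ D.lDeltaTheta l := by
  have h1 : (C.conjRoot hC τ f.1 k : D.GtpTheta) ∈ D.lDeltaTheta l :=
    (D.lDeltaTheta_normal l).conj_mem _ (hf.1 _) _
  have h2 : cobAt c (D.toTheta (k : D.PiTemp)) = (C.conjRoot hC τ f.1 k)⁻¹ * f'.1 k := by
    rw [hrel k, inv_mul_cancel_left]; rfl
  rw [h2, Subgroup.coe_mul, Subgroup.coe_inv]
  exact mul_mem (inv_mem h1) (hf'.1 k)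

/-- `∂c` is `l·Δ_Θ`-valued at every `x ∈ Π^tp_X` (its value depends only on the image in `G_K`, which
lifts to `Π^tp_Ÿ̲̲`). [cite: MochizukiEtTh2009, Def 2.13 p.47] -/
theorem cobAt_mem' (hC : D.Compat) {f f' : contCocycles D.toTheta D.DeltaTheta C.GtpYdduu}
    (hf : f ∈ C.rootCocycles hC) (hf' : f' ∈ C.rootCocycles hC) {τ : C.Huu} {c : D.DeltaTheta}
    (hrel : ∀ k : C.GtpYdduu,
      f'.1 k = C.conjRoot hC τ f.1 k * (MulAut.conjNormal (D.toTheta (k : D.PiTemp)) c * c⁻¹))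
    (x : D.PiTemp) : (cobAt c (D.toTheta x) : D.GtpTheta) ∈ D.lDeltaTheta l := by
  rw [cobAt_eq_of_aug_eq c (C.aug_lift ⟨D.aug.toMonoidHom x, D.aug_mem_GK x⟩).symm]
  exact cobAt_mem hC hf hf' hrel _

/-- The `G_K`-cocycle relating two theta sections: `γ ↦ (red ∂c(γ̃))⁻¹` for any lift `γ̃` of `γ` — the
Kummer-type shift of Def. 2.13 (i) / Prop. 2.14 (ii). [cite: MochizukiEtTh2009, Prop 2.14 (ii) p.49] -/
def cobChar (hC : D.Compat) {f f' : contCocycles D.toTheta D.DeltaTheta C.GtpYdduu}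
    (hf : f ∈ C.rootCocycles hC) (hf' : f' ∈ C.rootCocycles hC) {τ : C.Huu} {c : D.DeltaTheta}
    (hrel : ∀ k : C.GtpYdduu,
      f'.1 k = C.conjRoot hC τ f.1 k * (MulAut.conjNormal (D.toTheta (k : D.PiTemp)) c * c⁻¹)) :
    D.GK → MuN p N :=
  fun γ => (μ.red ⟨cobAt c (D.toTheta (C.lift γ : D.PiTemp)), cobAt_mem hC hf hf' hrel _⟩)⁻¹

/-- The value of `cobChar` at the image of any `x ∈ Π^tp_X`. [cite: MochizukiEtTh2009, Prop 2.14 (ii) p.49] -/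
theorem cobChar_aug (hC : D.Compat) {f f' : contCocycles D.toTheta D.DeltaTheta C.GtpYdduu}
    (hf : f ∈ C.rootCocycles hC) (hf' : f' ∈ C.rootCocycles hC) {τ : C.Huu} {c : D.DeltaTheta}
    (hrel : ∀ k : C.GtpYdduu,
      f'.1 k = C.conjRoot hC τ f.1 k * (MulAut.conjNormal (D.toTheta (k : D.PiTemp)) c * c⁻¹))
    (x : D.PiTemp) :
    cobChar μ hC hf hf' hrel ⟨D.aug.toMonoidHom x, D.aug_mem_GK x⟩ =
      (μ.red ⟨cobAt c (D.toTheta x), cobAt_mem' hC hf hf' hrel x⟩)⁻¹ := by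
  have h := cobAt_eq_of_aug_eq c (C.aug_lift ⟨D.aug.toMonoidHom x, D.aug_mem_GK x⟩)
  unfold cobChar
  congr 2
  exact Subtype.ext (congrArg (fun z : D.DeltaTheta => (z : D.GtpTheta)) h)

/-- `cobChar ∘ aug` is a 1-cocycle of `Π^tp_Y̲̲` for the cyclotomic character (from `cobAt_mul` and the
equivariance of `red`). [cite: MochizukiEtTh2009, Prop 2.14 (ii) p.49] -/
theorem isEnvCocycle_cobChar (hC : D.Compat) (hS : D.Sec2Hyps)
    {f f' : contCocycles D.toTheta D.DeltaTheta C.GtpYdduu}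
    (hf : f ∈ C.rootCocycles hC) (hf' : f' ∈ C.rootCocycles hC) {τ : C.Huu} {c : D.DeltaTheta}
    (hrel : ∀ k : C.GtpYdduu,
      f'.1 k = C.conjRoot hC τ f.1 k * (MulAut.conjNormal (D.toTheta (k : D.PiTemp)) c * c⁻¹)) :
    CycEnvelope.IsEnvCocycle (C.thetaEnvData μ hC hS).augY (C.thetaEnvData μ hC hS).chi
      (cobChar μ hC hf hf' hrel ∘ (C.thetaEnvData μ hC hS).augY) := by
  intro g h
  change cobChar μ hC hf hf' hrel ⟨D.aug.toMonoidHom ((g * h : (D.GtpY.subgroupOf C.Huu)) : C.Huu),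
      D.aug_mem_GK _⟩ =
    cobChar μ hC hf hf' hrel ⟨D.aug.toMonoidHom ((g : C.Huu) : D.PiTemp), D.aug_mem_GK _⟩ *
      galMuN p N (D.aug.toMonoidHom ((g : C.Huu) : D.PiTemp))
        (cobChar μ hC hf hf' hrel ⟨D.aug.toMonoidHom ((h : C.Huu) : D.PiTemp), D.aug_mem_GK _⟩)
  rw [cobChar_aug, cobChar_aug, cobChar_aug, map_inv, ← μ.red_conj, ← mul_inv, ← map_mul]
  congr 2
  apply Subtype.ext
  change (cobAt c (D.toTheta (((g * h : (D.GtpY.subgroupOf C.Huu)) : C.Huu) : D.PiTemp)) :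
      D.GtpTheta) = _
  rw [Subgroup.coe_mul, Subgroup.coe_mul, map_mul, cobAt_mul, Subgroup.coe_mul,
    MulAut.conjNormal_apply]
  rfl

/-- `cobChar ∘ aug` on `Π^tp_Y̲̲`, as an explicit (continuous) function.
[cite: MochizukiEtTh2009, Prop 2.14 (ii) p.49] -/
theorem cobChar_comp_augY (hC : D.Compat) (hS : D.Sec2Hyps)
    {f f' : contCocycles D.toTheta D.DeltaTheta C.GtpYdduu}
    (hf : f ∈ C.rootCocycles hC) (hf' : f' ∈ C.rootCocycles hC) {τ : C.Huu} {c : D.DeltaTheta}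
    (hrel : ∀ k : C.GtpYdduu,
      f'.1 k = C.conjRoot hC τ f.1 k * (MulAut.conjNormal (D.toTheta (k : D.PiTemp)) c * c⁻¹)) :
    cobChar μ hC hf hf' hrel ∘ (C.thetaEnvData μ hC hS).augY =
      fun g : (C.thetaEnvData μ hC hS).PiY =>
        (μ.red ⟨cobAt c (D.toTheta ((g : C.Huu) : D.PiTemp)), cobAt_mem' hC hf hf' hrel _⟩)⁻¹ := by
  funext g
  exact cobChar_aug μ hC hf hf' hrel _

/-- Continuity of `cobChar ∘ aug` on `Π^tp_Y̲̲`. [cite: MochizukiEtTh2009, Prop 2.14 (ii) p.49] -/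
theorem continuous_cobChar_comp_augY (hC : D.Compat) (hS : D.Sec2Hyps)
    {f f' : contCocycles D.toTheta D.DeltaTheta C.GtpYdduu}
    (hf : f ∈ C.rootCocycles hC) (hf' : f' ∈ C.rootCocycles hC) {τ : C.Huu} {c : D.DeltaTheta}
    (hrel : ∀ k : C.GtpYdduu,
      f'.1 k = C.conjRoot hC τ f.1 k * (MulAut.conjNormal (D.toTheta (k : D.PiTemp)) c * c⁻¹)) :
    Continuous (cobChar μ hC hf hf' hrel ∘ (C.thetaEnvData μ hC hS).augY) := by
  rw [cobChar_comp_augY]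
  refine (μ.continuous_red.comp (Continuous.subtype_mk ?_ _)).inv
  change Continuous fun g : D.GtpY.subgroupOf C.Huu =>
    ((cobAt c (D.toTheta ((g : C.Huu) : D.PiTemp)) : D.DeltaTheta) : D.GtpTheta)
  simp only [cobAt, Subgroup.coe_mul, Subgroup.coe_inv, MulAut.conjNormal_apply]
  have hT : Continuous fun g : D.GtpY.subgroupOf C.Huu => D.toTheta ((g : C.Huu) : D.PiTemp) :=
    D.continuous_toTheta.comp (continuous_subtype_val.comp continuous_subtype_val)
  exact ((hT.mul continuous_const).mul hT.inv).mul continuous_const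

/-- The shift by `cobChar` is a bi-continuous automorphism of `Π^tp_Y̲̲[μ_N]`.
[cite: MochizukiEtTh2009, Prop 2.14 (ii) p.49] -/
theorem shift_cobChar_mem_contMulAut (hC : D.Compat) (hS : D.Sec2Hyps)
    {f f' : contCocycles D.toTheta D.DeltaTheta C.GtpYdduu}
    (hf : f ∈ C.rootCocycles hC) (hf' : f' ∈ C.rootCocycles hC) {τ : C.Huu} {c : D.DeltaTheta}
    (hrel : ∀ k : C.GtpYdduu,
      f'.1 k = C.conjRoot hC τ f.1 k * (MulAut.conjNormal (D.toTheta (k : D.PiTemp)) c * c⁻¹)) :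
    CycEnvelope.shift (isEnvCocycle_cobChar μ hC hS hf hf' hrel) ∈
      contMulAut (C.thetaEnvData μ hC hS).env := by
  have hδ := continuous_cobChar_comp_augY μ hC hS hf hf' hrel
  have hl : Continuous fun x : (C.thetaEnvData μ hC hS).env => x.left :=
    (continuous_fst.comp continuous_induced_dom :
      Continuous (Prod.fst ∘ fun x : (C.thetaEnvData μ hC hS).env => (x.left, x.right)))
  have hr : Continuous fun x : (C.thetaEnvData μ hC hS).env => x.right :=
    (continuous_snd.comp continuous_induced_dom :
      Continuous (Prod.snd ∘ fun x : (C.thetaEnvData μ hC hS).env => (x.left, x.right)))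
  refine ⟨?_, ?_⟩
  · refine continuous_induced_rng.2 ?_
    change Continuous fun x : (C.thetaEnvData μ hC hS).env =>
      (x.left * (cobChar μ hC hf hf' hrel ∘ (C.thetaEnvData μ hC hS).augY) x.right, x.right)
    exact (hl.mul (hδ.comp hr)).prodMk hr
  · refine continuous_induced_rng.2 ?_
    change Continuous fun x : (C.thetaEnvData μ hC hS).env =>
      (x.left * ((cobChar μ hC hf hf' hrel ∘ (C.thetaEnvData μ hC hS).augY) x.right)⁻¹, x.right)
    exact (hl.mul (hδ.comp hr).inv).prodMk hr

/-- **All theta sections of `X̲̲` are `K^×, (l·ℤ)`-conjugate** (pp. 46–47; the axiom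
`RigidData.thetaSections_conj` of `ThetaRigidity.lean`, PROVED for the instantiated data): for theta
cocycles `η, η'` of the collection, `s^Θ(η')` is obtained from `s^Θ(η)` by the outer action of an element
`τ ∈ Π^tp_X̲̲` (`conjX`) followed by the shift by the `G_K`-cocycle `cobChar`.
[cite: MochizukiEtTh2009, Def 2.13 p.47] -/
theorem thetaSections_isKLConjugate (hC : D.Compat) (hS : D.Sec2Hyps)
    {η η' : (C.thetaEnvData μ hC hS).PiYdd → MuN p N}
    (hη : η ∈ (C.thetaEnvData μ hC hS).thetaCocycles)
    (hη' : η' ∈ (C.thetaEnvData μ hC hS).thetaCocycles) :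
    (C.thetaEnvData μ hC hS).IsKLConjugate ((C.thetaEnvData μ hC hS).sTheta hη)
      ((C.thetaEnvData μ hC hS).sTheta hη') := by
  set T := C.thetaEnvData μ hC hS with hTdef
  obtain ⟨f, hf, rfl⟩ := hη
  obtain ⟨f', hf', rfl⟩ := hη'
  obtain ⟨τ, c, hrel⟩ := C.rootCocycles_rel hC hf hf'
  -- the `gal` conjugate by `τ`, then the `kummer` shift by `cobChar`
  have h1 := ThetaEnvData.IsKLConjugate.gal (T := T) _ τ
    (ThetaEnvData.IsKLConjugate.base (T := T) (s := T.sTheta ⟨f, hf, rfl⟩))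
  have h2 := ThetaEnvData.IsKLConjugate.kummer (T := T) _ (cobChar μ hC hf hf' hrel)
    (isEnvCocycle_cobChar μ hC hS hf hf' hrel) (shift_cobChar_mem_contMulAut μ hC hS hf hf' hrel) h1
  convert h2 using 1
  funext g
  symm
  -- compute both sides in `μ_N ⋊ Π^tp_Y̲̲`
  have hgτ : D.aug.toMonoidHom (((τ * (τ⁻¹ * g * τ) * τ⁻¹ : C.Huu)) : D.PiTemp) =
      D.aug.toMonoidHom ((g : C.Huu) : D.PiTemp) := by
    congr 1
    simp only [Subgroup.coe_mul, Subgroup.coe_inv]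
    group
  apply SemidirectProduct.ext
  · -- the `μ_N`-component
    change galMuN p N (D.aug.toMonoidHom ((τ : C.Huu) : D.PiTemp))
        (C.modN μ f hf.1 ⟨τ⁻¹ * (g : C.Huu) * τ, _⟩)⁻¹ *
      (cobChar μ hC hf hf' hrel ∘ T.augY) ⟨τ * (τ⁻¹ * (g : C.Huu) * τ) * τ⁻¹, _⟩ =
      (C.modN μ f' hf'.1 g)⁻¹
    rw [Function.comp_apply]
    change galMuN p N (D.aug.toMonoidHom ((τ : C.Huu) : D.PiTemp))
        (C.modN μ f hf.1 ⟨τ⁻¹ * (g : C.Huu) * τ, _⟩)⁻¹ *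
      cobChar μ hC hf hf' hrel ⟨D.aug.toMonoidHom (((τ * (τ⁻¹ * g * τ) * τ⁻¹ : C.Huu)) : D.PiTemp),
        D.aug_mem_GK _⟩ = (C.modN μ f' hf'.1 g)⁻¹
    have hγ : (⟨D.aug.toMonoidHom (((τ * (τ⁻¹ * g * τ) * τ⁻¹ : C.Huu)) : D.PiTemp), D.aug_mem_GK _⟩ :
        D.GK) = ⟨D.aug.toMonoidHom ((g : C.Huu) : D.PiTemp), D.aug_mem_GK _⟩ := Subtype.ext hgτ
    rw [hγ, cobChar_aug, map_inv, ← mul_inv]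
    congr 1
    unfold modN
    rw [← μ.red_conj, ← map_mul]
    congr 1
    apply Subtype.ext
    rw [Subgroup.coe_mul]
    change _ = ((f'.1 (C.inclYdduu g) : D.DeltaTheta) : D.GtpTheta)
    rw [hrel (C.inclYdduu g), Subgroup.coe_mul]
    congr 1
  · -- the `Π^tp_Y̲̲`-component
    apply Subtype.ext
    change ((τ * (τ⁻¹ * (g : C.Huu) * τ) * τ⁻¹ : C.Huu)) = (g : C.Huu)
    group

end Sections

end EtaleThetaData.DoubleUnderline

end ThetaSetting

end Literature.AnabelianGeometry.EtaleTheta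

end
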